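import Literature.Probability.RandomPlanarGeometry.RestrictionReflection
import Literature.Probability.RandomPlanarGeometry.JoukowskiArcHulls
import HarnessLib

/-!
# [LSW] Remark 3.7: a restriction measure `P_α` has `α ≥ 1/2` (the elementary symmetry bound), proved

A PROVED partial result towards [LSW] Cor. 8.6 ("`P_α` does not exist for `α < 5/8`", the deep
`α < 5/8` half of the named fact
`Literature.Probability.RandomPlanarGeometry.IsRestrictionMeasure.eq_five_eighths_of_outer_simple` of `RestrictionMeasures`,
whose only proof goes through SLE(8/3, ρ), `OneSidedRestriction` / `RestrictionLeftFillLaw`), after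

* G. F. Lawler, O. Schramm, W. Werner, *Conformal restriction: the chordal case*, J. Amer. Math.
  Soc. **16** (2003) 917–955, arXiv:math/0209343 (**[LSW]**, arXiv page numbers), Remark 3.7
  (pp. 13–14), verbatim: "When `α < 1/2`, the measure `P_α` does not exist. To see this,
  suppose it did. Since it is unique, it is invariant under the symmetry `σ : x + iy ↦ −x + iy`.
  Let `A = {e^{iθ} : θ ∈ [0, π/2]}`. Since `K` is almost surely connected and joins `0` to
  infinity, it meets either `A` or `σ(A)`. Hence, symmetry implies that
  `Φ'_A(0)^α = P[K ∩ A = ∅] ≤ 1/2`. On the other hand, one can calculate directly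
  `Φ'_A(0) = 1/4`, and hence `α ≥ 1/2`."

Everything is in the tree: the `σ`-invariance of `P_α` and the abstract symmetry bound
(`IsRestrictionMeasure.measure_le_half_of_disjoint_reflect`, `RestrictionReflection`, resting on
the discharged uniqueness of `P_α`), and the quarter arc with its explicit restriction map and
`Φ'(0) = 1/4` (`circArcHull 0 2 = σ(A) = {e^{iθ} : θ ∈ [π/2, π]}`,
`hasRestrictionDeriv_joukowskiArcMap`, `JoukowskiArcHulls`). PROVED here:

* `Literature.Probability.RandomPlanarGeometry.RestrictionConfig.exists_mem_norm_eq_one` — every `K ∈ Ω` meets the unit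
  circle ("`K` is connected and joins `0` to infinity": it has points inside the unit disc, as
  `0 ∈ cl K`, and outside, being unbounded; intermediate value theorem for `|·|` on the
  connected `K`), hence meets `σ(A)` or `A = σ(σ(A))` (`not_disjoint_quarterArc_and_reflect`);
* `Literature.Probability.RandomPlanarGeometry.IsRestrictionMeasure.measure_avoid_quarterArc_le_half` —
  `P_α[K ∩ σ(A) = ∅] ≤ 1/2`, and `= (1/4)^α` (`measure_avoid_quarterArc`);
* `Literature.Probability.RandomPlanarGeometry.IsRestrictionMeasure.one_half_le` — **`1/2 ≤ α`** for every `P` with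
  `IsRestrictionMeasure α P`; equivalently `not_exists_isRestrictionMeasure_of_lt_one_half`.

Mathlib: `IsPreconnected.intermediate_value`, `Real.rpow_le_rpow_left_iff_of_base_lt_one`,
`Real.rpow_mul`, `ENNReal.ofReal_le_ofReal_iff`.
-/

noncomputable section

open Set Filter Topology MeasureTheory
open UpperHalfPlane (upperHalfPlaneSet)
open scoped NNReal ENNReal

namespace Literature.Probability.RandomPlanarGeometry

namespace RestrictionConfig

/-- **Every configuration meets the unit circle** ([LSW] Rem. 3.7: "`K` is almost surely
connected and joins `0` to infinity"): `K` has a point of norm `< 1` (`0 ∈ cl K`) and a point of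
norm `> 1` (`K` is unbounded), and is connected. [cite: LawlerSchrammWerner2003Restriction, Remark 3.7 (pp. 13–14)] -/
theorem exists_mem_norm_eq_one (K : RestrictionConfig) : ∃ w ∈ (K : Set ℂ), ‖w‖ = 1 := by
  obtain ⟨k₁, hk₁K, hk₁⟩ : ∃ k ∈ (K : Set ℂ), ‖k‖ < 1 := by
    have h0 := K.zero_mem_closure
    rw [Metric.mem_closure_iff] at h0
    obtain ⟨k, hk, hd⟩ := h0 1 one_pos
    refine ⟨k, hk, ?_⟩
    rwa [dist_comm, dist_zero_right] at hd
  obtain ⟨k₂, hk₂K, hk₂⟩ : ∃ k ∈ (K : Set ℂ), 1 < ‖k‖ := by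
    by_contra h
    push Not at h
    exact K.not_isBounded ((Metric.isBounded_closedBall (x := (0 : ℂ)) (r := 1)).subset
      fun k hk ↦ by simpa using h k hk)
  obtain ⟨w, hw, hw1⟩ := K.isConnected.isPreconnected.intermediate_value hk₁K hk₂K
    continuous_norm.continuousOn ⟨hk₁.le, hk₂.le⟩
  exact ⟨w, hw, hw1⟩

/-- **No configuration avoids both quarter arcs** ([LSW] Rem. 3.7: "it meets either `A` or
`σ(A)`"): a point of `K ⊆ ℍ` on the unit circle lies on the left quarter arc
`circArcHull 0 2 = {e^{iθ} : θ ∈ [π/2, π]}` if its real part is `≤ 0`, and otherwise its mirror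
image does. [cite: LawlerSchrammWerner2003Restriction, Remark 3.7 (pp. 13–14)] -/
theorem not_disjoint_quarterArc_and_reflect (K : RestrictionConfig) :
    ¬ (Disjoint (K : Set ℂ) (circArcHull 0 2) ∧
        Disjoint (K : Set ℂ) (imagAxisRefl '' circArcHull 0 2)) := by
  rintro ⟨h₁, h₂⟩
  obtain ⟨w, hwK, hw1⟩ := K.exists_mem_norm_eq_one
  have hwH : w ∈ upperHalfPlaneSet := K.subset_upperHalfPlaneSet hwK
  rcases le_or_gt w.re 0 with hre | hre
  · exact Set.disjoint_left.1 h₁ hwK (subset_closure ⟨hwH, hw1, Or.inl (by linarith)⟩)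
  · refine Set.disjoint_left.1 h₂ hwK
      ⟨imagAxisRefl w, subset_closure ⟨?_, ?_, Or.inl ?_⟩, imagAxisRefl_imagAxisRefl w⟩
    · show 0 < (imagAxisRefl w).im
      rw [imagAxisRefl_im]
      exact hwH
    · rw [norm_imagAxisRefl, hw1]
    · rw [imagAxisRefl_re]
      linarith

end RestrictionConfig

open RestrictionConfig

/-- **`P_α[K ∩ σ(A) = ∅] ≤ 1/2`** for the quarter arc ([LSW] Rem. 3.7: "symmetry implies that
`Φ'_A(0)^α = P[K ∩ A = ∅] ≤ 1/2`"): the avoidance event of `σ(A) = circArcHull 0 2` is disjoint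
from its mirror image `{K ∩ A = ∅}` (`not_disjoint_quarterArc_and_reflect`) and `P_α` is
`σ`-invariant (`IsRestrictionMeasure.measure_le_half_of_disjoint_reflect`).
[cite: LawlerSchrammWerner2003Restriction, Remark 3.7 (pp. 13–14)] -/
theorem IsRestrictionMeasure.measure_avoid_quarterArc_le_half {α : ℝ} {P : Measure RestrictionConfig}
    (h : IsRestrictionMeasure α P) : P (avoid (circArcHull 0 2)) ≤ 1 / 2 := by
  refine h.measure_le_half_of_disjoint_reflect
    (measurableSet_avoid (isStarHull_circArcHull (by norm_num) (by norm_num) le_rfl)) ?_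
  rw [reflect_preimage_avoid, Set.disjoint_left]
  intro K h₁ h₂
  exact K.not_disjoint_quarterArc_and_reflect ⟨h₁, h₂⟩

/-- **`P_α[K ∩ σ(A) = ∅] = (1/4)^α`** ([LSW] Rem. 3.7: "one can calculate directly
`Φ'_A(0) = 1/4`" — the tree's `hasRestrictionDeriv_joukowskiArcMap` at `p = 0`, `q = 2`).
[cite: LawlerSchrammWerner2003Restriction, Remark 3.7 (pp. 13–14)] -/
theorem IsRestrictionMeasure.measure_avoid_quarterArc {α : ℝ} {P : Measure RestrictionConfig}
    (h : IsRestrictionMeasure α P) :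
    P (avoid (circArcHull 0 2)) = ENNReal.ofReal ((1 / 4 : ℝ) ^ α) := by
  have h0 : (-2 : ℝ) ≤ 0 := by norm_num
  have h02 : (0 : ℝ) < 2 := by norm_num
  rw [h.2 (isStarHull_circArcHull h0 h02 le_rfl) (isRestrictionMap_joukowskiArcMap h0 h02 le_rfl)
    (hasRestrictionDeriv_joukowskiArcMap h0 h02 le_rfl)]
  norm_num

/-- **[LSW] Remark 3.7: `α ≥ 1/2` for every restriction measure `P_α`** ("When `α < 1/2`, the
measure `P_α` does not exist"): `(1/4)^α = P_α[K ∩ σ(A) = ∅] ≤ 1/2`. (The sharp bound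
`α ≥ 5/8` is Cor. 8.6, via SLE(8/3, ρ).) [cite: LawlerSchrammWerner2003Restriction, Remark 3.7 (pp. 13–14)] -/
theorem IsRestrictionMeasure.one_half_le {α : ℝ} {P : Measure RestrictionConfig}
    (h : IsRestrictionMeasure α P) : 1 / 2 ≤ α := by
  have h1 := h.measure_avoid_quarterArc_le_half
  rw [h.measure_avoid_quarterArc, show (1 / 2 : ℝ≥0∞) = ENNReal.ofReal (1 / 2) by
    rw [ENNReal.ofReal_div_of_pos two_pos, ENNReal.ofReal_one, ENNReal.ofReal_ofNat],
    ENNReal.ofReal_le_ofReal_iff (by norm_num)] at h1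
  -- `(1/4)^α = (1/2)^(2α) ≤ (1/2)^1`
  have h4 : (1 / 4 : ℝ) ^ α = (1 / 2 : ℝ) ^ (2 * α) := by
    rw [Real.rpow_mul (by norm_num : (0 : ℝ) ≤ 1 / 2)]
    norm_num
  rw [h4, ← Real.rpow_one (1 / 2 : ℝ),
    show ((1 / 2 : ℝ) ^ (1 : ℝ)) ^ (2 * α) = (1 / 2 : ℝ) ^ (2 * α) by rw [Real.rpow_one],
    Real.rpow_le_rpow_left_iff_of_base_lt_one (by norm_num) (by norm_num)] at h1
  linarith

/-- **No `P_α` for `α < 1/2`** ([LSW] Remark 3.7, first sentence). [cite: LawlerSchrammWerner2003Restriction, Remark 3.7 (pp. 13–14)] -/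
theorem not_exists_isRestrictionMeasure_of_lt_one_half {α : ℝ} (hα : α < 1 / 2) :
    ¬ ∃ P : Measure RestrictionConfig, IsRestrictionMeasure α P := fun ⟨_, hP⟩ ↦
  absurd hP.one_half_le (not_le.2 hα)

end Literature.Probability.RandomPlanarGeometry

end
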